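import Summits.NavierStokesRegularity.NavierStokesRegularity.Theorems.RecurrentProfilesRecurrentLiouvilleLebSubcriticalBackward
import Summits.NavierStokesRegularity.NavierStokesRegularity.Theorems.RecurrentProfilesRecurrentLiouvilleFrHarvest
import HarnessLib

/-!
# Crux `RecurrentLiouville` (stmt-NavierStokesRegularity-1589), line `Sketch` (v8 "Lebesgue rungs") —
  stub S4: the supercritical final-time `L^q` rung (`3 < q < ∞`)

`stub_lebSupercriticalFinal`: let `(u, p)` be a suitable weak solution of Navier–Stokes (`ν = 1`,
`f = 0`) on the backward slab `ℝ³ × ℝ₋ = (-∞, 0) × ℝ³` with weak gradient `G`, Albritton–Barker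
quantity `𝐈(ℝ³ × ℝ₋) < ∞` and the Type-I rate `‖u(t, x)‖ ≤ C/√(−t)`.  If for some `3 < q < ∞` the
slices `u(t)` are bounded in `L^q(ℝ³)`, `‖u(t)‖_{L^q} ≤ E < ∞`, for almost every time `t` of some
final interval `(T₀, 0)`, `T₀ < 0`, then the space–time origin is NOT a backward singular point of
`u`.  This is the Type-I-class form of the Ladyzhenskaya–Prodi–Serrin criterion `u ∈ L^∞_t L^q_x`,
`q > 3` (cf. Escauriaza–Seregin–Šverák 2003, §1), i.e. the supercritical Lebesgue rung of D. Chae's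
exclusion scheme (Math. Ann. 338 (2007), Thm 1.5) in the decay-free suitable weak Type-I class.

Proof (zoom-IN along the scaling orbit; bookkeeping over tree-proved facts, no compactness).
* Smallness (`lebSup_eLpNorm_nsRescale_cylinder_le`): for `c > 0` with `c² R² ≤ −T₀` the zoomed
  field `u_c(t, x) = c u(c² t, c x)` agrees on `Q(0, R) = (−R², 0) × B(0, R)` with the zoom of the
  truncation `v = 𝟙_{t > T₀} u`, whose slices obey `‖v(t)‖_{L^q} ≤ E` for a.e. `t < 0`; the landed
  subcritical box bound `lebSub_eLpNorm_nsRescale_box_le` (exact space–time scaling law of `L^q`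
  norms, Jacobian `c⁵`, and Tonelli in time) with `δ = 0` gives
  `‖u_c‖_{L^q(Q(0,R))} ≤ c (c⁵)^{-1/q} (c² R²)^{1/q} E = c^{1 − 3/q} R^{2/q} E`.
* `lebSup_tendsto_scalingFactor`: `c^{1 − 3/q} R^{2/q} → 0` as `c → 0⁺`, since `1 − 3/q > 0`.
* Hölder on the finite-measure ball `Q(0, R)` (`L^q → L³`, `q ≥ 3`): along `c_n = 1/(n+1) → 0⁺`
  the zooms `u_{c_n}` tend to `0` in every `L³(Q(0, R))`, so `0` is an `L³_loc` cluster point of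
  the scaling orbit, which the landed Chae rung `fr_zero_not_clusterPoint` (p148324 ff.) forbids
  for a singular origin.

## References

* D. Chae, *Nonexistence of asymptotically self-similar singularities in the Euler and the
  Navier–Stokes equations*, Math. Ann. 338 (2007) 435–449 = arXiv:math/0604234, Thm 1.5. [Chae2007]
* D. Albritton, T. Barker, *On local Type I singularities of the Navier–Stokes equations and
  Liouville theorems*, J. Math. Fluid Mech. 21 (2019) no. 43 = arXiv:1811.00502, Lemma 2.2,
  Prop. 2.3, §3. [AlbrittonBarker2019]
* L. Escauriaza, G. Seregin, V. Šverák, *`L_{3,∞}`-solutions of Navier–Stokes equations and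
  backward uniqueness*, Russian Math. Surveys 58 (2003) 211–250, §1. [EscauriazaSereginSverak2003]
-/

noncomputable section

-- the sub-problem namespace repeats the summit name (D-0017 layout `Summit.<S>.<P>.Theorems`)
set_option linter.dupNamespace false

namespace Summit.NavierStokesRegularity.NavierStokesRegularity.Theorems

open MeasureTheory Set Function Filter Topology TopologicalSpace Metric
open Literature.Analysis Literature.Analysis.FluidPDE
open scoped NNReal ENNReal

/-! ## Real-variable bookkeeping: the zoom-in factor `c^{1 - 3/q}` -/

-- adapted from `lebSub_scalingFactor_eq` (…LebSubcriticalBackward, private there)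
/-- The scaling identity `c · (c⁵)^{-1/q} · (c² K)^{1/q} = c^{1 − 3/q} K^{1/q}` (`c > 0`, `K ≥ 0`).
[folklore] -/
private theorem lebSup_scalingFactor_eq {c q K : ℝ} (hc : 0 < c) (hK : 0 ≤ K) :
    c * ((c ^ 2 * c ^ 3)⁻¹) ^ (1 / q) * (c ^ 2 * K) ^ (1 / q) =
      c ^ (1 - 3 / q) * K ^ (1 / q) := by
  have h5 : (c ^ 2 * c ^ 3) ^ (1 / q) = c ^ (5 / q) := by
    rw [← pow_add, ← Real.rpow_natCast, ← Real.rpow_mul hc.le]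
    congr 1
    push_cast
    ring
  have h2 : (c ^ 2) ^ (1 / q) = c ^ (2 / q) := by
    rw [← Real.rpow_natCast, ← Real.rpow_mul hc.le]
    congr 1
    push_cast
    ring
  rw [Real.mul_rpow (by positivity) hK, Real.inv_rpow (by positivity), h5, h2, ← Real.rpow_neg hc.le,
    show c ^ (1 - 3 / q) = c ^ ((1 : ℝ) + -(5 / q) + 2 / q) by congr 1; ring,
    Real.rpow_add hc, Real.rpow_add hc, Real.rpow_one]
  ring

/-- **The zoom-in factor tends to zero for supercritical exponents**: for `3 < q` and every `R`,
`c · (c⁵)^{-1/q} · (c² R²)^{1/q} = c^{1 − 3/q} R^{2/q} → 0` as `c → 0⁺` (`1 − 3/q > 0`). [folklore] -/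
theorem lebSup_tendsto_scalingFactor {q : ℝ} (hq3 : 3 < q) (R : ℝ) :
    Tendsto (fun c : ℝ => c * ((c ^ 2 * c ^ 3)⁻¹) ^ (1 / q) * (c ^ 2 * R ^ 2) ^ (1 / q))
      (𝓝[>] 0) (𝓝 0) := by
  have hq0 : 0 < q := by linarith
  have hexp : 0 < 1 - 3 / q := by
    rw [sub_pos, div_lt_one hq0]
    exact hq3
  have h1 : Tendsto (fun c : ℝ => c ^ (1 - 3 / q)) (𝓝[>] 0) (𝓝 0) := by
    have h := (Real.continuousAt_rpow_const 0 (1 - 3 / q) (Or.inr hexp.le)).tendsto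
    rw [Real.zero_rpow hexp.ne'] at h
    exact tendsto_nhdsWithin_of_tendsto_nhds h
  have h2 := h1.mul_const ((R ^ 2) ^ (1 / q))
  rw [zero_mul] at h2
  refine h2.congr' ?_
  filter_upwards [self_mem_nhdsWithin] with c hc
  exact (lebSup_scalingFactor_eq hc (sq_nonneg R)).symm

/-! ## Smallness of the zoomed-in fields on parabolic balls -/

/-- **Smallness of zoomed-in fields on parabolic balls** (the supercritical scaling gain).  If
`‖u(t)‖_{L^q} ≤ E` for a.e. `T₀ < t < 0`, then for `c > 0` with `c² R² ≤ −T₀`,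
`‖u_c‖_{L^q(Q(0,R))} ≤ c (c⁵)^{-1/q} (c² R²)^{1/q} · E`: on `Q(0, R) = (−R², 0) × B(0, R)` the zoom
`u_c` agrees with the zoom of the truncation `v = 𝟙_{t > T₀} u` (`c² t > −c² R² ≥ T₀`), whose slices
are bounded by `E` for a.e. `t < 0`, so the landed box bound `lebSub_eLpNorm_nsRescale_box_le`
(exact scaling law `eLpNorm_nsRescale_restrict_preimage`, Jacobian `c^{2+3}`, and Tonelli in time)
applies with `δ = 0`. [cite: AlbrittonBarker2019, §3 (scaling of the class)] -/
theorem lebSup_eLpNorm_nsRescale_cylinder_le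
    {u : ℝ → EuclideanSpace ℝ (Fin 3) → EuclideanSpace ℝ (Fin 3)} {q : ℝ≥0∞} (hq0 : q ≠ 0)
    (hqt : q ≠ ⊤) {T₀ : ℝ} {E : ℝ≥0∞}
    (hbd : ∀ᵐ t ∂(volume : Measure ℝ), T₀ < t → t < 0 → eLpNorm (u t) q volume ≤ E)
    {c R : ℝ} (hc : 0 < c) (hcT : c ^ 2 * R ^ 2 ≤ -T₀) :
    eLpNorm (uncurry (nsRescale c u)) q
        (volume.restrict (parabolicCylinder R (0 : ℝ × EuclideanSpace ℝ (Fin 3)))) ≤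
      ENNReal.ofReal (c * ((c ^ 2 * c ^ 3)⁻¹) ^ (1 / q.toReal) *
        (c ^ 2 * R ^ 2) ^ (1 / q.toReal)) * E := by
  -- the truncation of `u` below the time `T₀`
  obtain ⟨v, hv1, hv2⟩ : ∃ v : ℝ → EuclideanSpace ℝ (Fin 3) → EuclideanSpace ℝ (Fin 3),
      (∀ t, T₀ < t → v t = u t) ∧ (∀ t, ¬ T₀ < t → v t = 0) :=
    ⟨fun t => if T₀ < t then u t else 0, fun t ht => if_pos ht, fun t ht => if_neg ht⟩
  have hbd' : ∀ᵐ t ∂(volume : Measure ℝ), t < 0 → eLpNorm (v t) q volume ≤ E := by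
    filter_upwards [hbd] with t ht ht0
    by_cases h : T₀ < t
    · rw [hv1 t h]
      exact ht h ht0
    · rw [hv2 t h, eLpNorm_zero]
      exact bot_le
  -- the two zooms agree on `Q(0, R)`
  have heq : ∀ z ∈ parabolicCylinder R (0 : ℝ × EuclideanSpace ℝ (Fin 3)),
      uncurry (nsRescale c u) z = uncurry (nsRescale c v) z := by
    rintro ⟨s, y⟩ hz
    rw [SuitableCompactness.mem_parabolicCylinder_zero] at hz
    have hs : T₀ < c ^ 2 * s := by
      nlinarith [mul_pos (pow_pos hc 2) (show 0 < s + R ^ 2 by linarith [hz.1.1])]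
    simp only [uncurry_apply_pair, nsRescale_apply, hv1 _ hs]
  have hbox := lebSub_eLpNorm_nsRescale_box_le hq0 hqt hbd' hc (δ := 0) (R := R)
    (by rw [mul_zero, neg_zero]) (sq_nonneg R)
  simp only [mul_zero, neg_zero, zero_sub, neg_neg] at hbox
  rw [eLpNorm_congr_ae (((ae_restrict_mem (isOpen_parabolicCylinder R _).measurableSet)).mono heq),
    SuitableCompactness.parabolicCylinder_zero]
  exact hbox

/-! ## Stub S4 — the supercritical final-time `L^q` rung -/

/-- **S4 — supercritical final-time integrability rung.**  For `3 < q < ∞`: a suitable weak solution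
`(u,p)` on `ℝ³ × ℝ₋` with weak gradient `G`, `𝐈 < ⊤` and the rate `C`, whose slices are bounded in
`L^q(ℝ³)` for almost every time of some final interval `(T₀, 0)`, is regular at the origin: along the
zoom-in scales `c_n = 1/(n+1) → 0⁺` one has `‖u_{c_n}‖_{L^q(Q(0,R))} ≲ c_n^{1−3/q} → 0`
(`lebSup_eLpNorm_nsRescale_cylinder_le`, `lebSup_tendsto_scalingFactor`), hence
`u_{c_n} → 0` in every `L³(Q(0,R))` by Hölder on the finite-measure ball, and `0` is not an `L³_loc`
cluster point of the scaling orbit of a Type-I singularity model (Chae rung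
`fr_zero_not_clusterPoint`).  The Type-I-class form of the Ladyzhenskaya–Prodi–Serrin criterion
`L^∞_t L^q_x`, `q > 3`. [cite: Chae2007, Thm 1.5; EscauriazaSereginSverak2003, §1] -/
theorem stub_lebSupercriticalFinal :
    ∀ (q : ℝ≥0∞), 3 < q → q < ⊤ →
    ∀ (C : ℝ) (u : ℝ → EuclideanSpace ℝ (Fin 3) → EuclideanSpace ℝ (Fin 3))
      (p : ℝ → EuclideanSpace ℝ (Fin 3) → ℝ)
      (G : ℝ → EuclideanSpace ℝ (Fin 3) → EuclideanSpace ℝ (Fin 3) →L[ℝ] EuclideanSpace ℝ (Fin 3)),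
      IsSuitableWeakSolutionOn (slab (EuclideanSpace ℝ (Fin 3)) (Iio 0) isOpen_Iio) 1 0 u p →
      HasWeakSpatialGradientOn (slab (EuclideanSpace ℝ (Fin 3)) (Iio 0) isOpen_Iio) u G →
      typeIBound (Iio (0 : ℝ) ×ˢ univ) u p G < ⊤ →
      HasTypeITimeDecay C u →
      (∃ (E : ℝ≥0∞) (T₀ : ℝ), E < ⊤ ∧ T₀ < 0 ∧
        ∀ᵐ t ∂(volume : Measure ℝ), T₀ < t → t < 0 → eLpNorm (u t) q volume ≤ E) →
      ¬ IsBackwardSingularPoint u 0 := by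
  intro q hq3 hqt C u p G hsw hwg hI hdec hLq
  obtain ⟨E, T₀, hE, hT₀, hbd⟩ := hLq
  -- exponent bookkeeping
  have hqt' : q ≠ ⊤ := hqt.ne
  have hq0 : q ≠ 0 := (lt_trans (by norm_num) hq3).ne'
  have hq3' : 3 < q.toReal := by
    have h := (ENNReal.toReal_lt_toReal (by norm_num : (3 : ℝ≥0∞) ≠ ⊤) hqt').2 hq3
    simpa using h
  -- the zoom-in scales `c_n = 1/(n+1) → 0⁺`
  obtain ⟨c, hc, hc0⟩ : ∃ c : ℕ → ℝ, (∀ n, 0 < c n) ∧ Tendsto c atTop (𝓝 0) :=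
    ⟨fun n => 1 / ((n : ℝ) + 1), fun n => by positivity, tendsto_one_div_add_atTop_nhds_zero_nat⟩
  have hc0' : Tendsto c atTop (𝓝[>] 0) :=
    tendsto_nhdsWithin_iff.2 ⟨hc0, Eventually.of_forall fun n => hc n⟩
  refine fr_zero_not_clusterPoint C u p G hsw hwg hI hdec c hc fun R _ => ?_
  set Q : Set (ℝ × EuclideanSpace ℝ (Fin 3)) :=
    parabolicCylinder R (0 : ℝ × EuclideanSpace ℝ (Fin 3)) with hQ
  -- the Hölder factor `|Q(0,R)|^{1/3 - 1/q}` is finite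
  set M : ℝ≥0∞ := volume Q ^ (1 / (3 : ℝ≥0∞).toReal - 1 / q.toReal) with hM
  have hMt : M ≠ ⊤ := by
    refine ENNReal.rpow_ne_top_of_nonneg ?_ (volume_parabolicCylinder_ne_top R _)
    rw [sub_nonneg, ENNReal.toReal_ofNat]
    exact one_div_le_one_div_of_le (by norm_num) hq3'.le
  -- measurability of the zooms on `Q(0, R)`
  have hvm : ∀ n, AEStronglyMeasurable (uncurry (nsRescale (c n) u)) (volume.restrict Q) := by
    intro n
    rw [nsRescale_eq_zoom]
    exact (zoom_slabProfile hsw hwg (hc n)).2.1.locallyIntegrableOn.aestronglyMeasurable.mono_measure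
      (Measure.restrict_mono (parabolicCylinder_origin_subset_slab _) le_rfl)
  -- Step 1: `L^q(Q) → L³(Q)` on the finite-measure ball (`3 ≤ q`)
  have hstep : ∀ n, eLpNorm (uncurry (nsRescale (c n) u)) 3 (volume.restrict Q) ≤
      eLpNorm (uncurry (nsRescale (c n) u)) q (volume.restrict Q) * M := by
    intro n
    have h := eLpNorm_le_eLpNorm_mul_rpow_measure_univ hq3.le (hvm n)
    rwa [Measure.restrict_apply_univ] at h
  -- Step 2: eventually `c_n² R² ≤ -T₀`, so the smallness bound applies
  have hev : ∀ᶠ n in atTop, eLpNorm (uncurry (nsRescale (c n) u)) q (volume.restrict Q) ≤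
      ENNReal.ofReal (c n * ((c n ^ 2 * c n ^ 3)⁻¹) ^ (1 / q.toReal) *
        (c n ^ 2 * R ^ 2) ^ (1 / q.toReal)) * E := by
    have h2 : Tendsto (fun n => c n ^ 2 * R ^ 2) atTop (𝓝 0) := by
      have h := (hc0.pow 2).mul_const (R ^ 2)
      simpa using h
    filter_upwards [h2.eventually (eventually_lt_nhds (neg_pos.2 hT₀))] with n hn
    exact lebSup_eLpNorm_nsRescale_cylinder_le hq0 hqt' hbd (hc n) hn.le
  -- Step 3: the majorant tends to zero
  have hlim : Tendsto (fun n => ENNReal.ofReal (c n * ((c n ^ 2 * c n ^ 3)⁻¹) ^ (1 / q.toReal) *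
      (c n ^ 2 * R ^ 2) ^ (1 / q.toReal)) * E * M) atTop (𝓝 0) := by
    have hg := (lebSup_tendsto_scalingFactor hq3' R).comp hc0'
    have h := ENNReal.Tendsto.mul_const (ENNReal.tendsto_ofReal hg) (Or.inr hE.ne)
    rw [ENNReal.ofReal_zero, zero_mul] at h
    have h' := ENNReal.Tendsto.mul_const h (Or.inr hMt)
    rwa [zero_mul] at h'
  -- Step 4: squeeze
  refine tendsto_of_tendsto_of_tendsto_of_le_of_le' tendsto_const_nhds hlim
    (Eventually.of_forall fun _ => zero_le) ?_
  filter_upwards [hev] with n hn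
  exact (hstep n).trans (by gcongr)

end Summit.NavierStokesRegularity.NavierStokesRegularity.Theorems

end
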